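import Literature.IUT.HodgeArakelov.CohomologyLimitCongr

/-!
# Functoriality of the pull-back of `lim_K H¹(H|_K, A)` and the SECTION IDENTITY `ι^* ∘ proj^* = id`
# (proof-only companion to `CohomologyLimitComap.lean` / `CohomologyLimitCongr.lean`)

Companion (abc-iut cell, layer L6, seat abc-iut-w4-d004 gen 2; node IUTchII:Cor3.5(ii), restriction-ISO clause
input (R) of `BadPrimeGaussianMonoidsRestrictionIsoKummerProofs.lean`). S. Mochizuki, *Inter-universal Teichmüller
theory II*, kurims manuscript (Dec. 2020), Cor. 3.5 (i) p. 94: "by restricting the monoid `Ψ_cns(M^Θ_*)` … via the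
restriction operations [i.e., to '`Π_{M^Θ_*▶}`' and '`D^δ_{t,μ_-}`'] … `Π_v▶(M^Θ_*▶) ↠ G_v(M^Θ_*▶)_{⟨|F_l|⟩} ↷ Ψ_cns(M^Θ_*)
⥲ Ψ_cns(M^Θ_*)_{⟨|F_l|⟩}` … the bottom horizontal arrow is an isomorphism of monoids … this inner automorphism
indeterminacy … is, in fact, independent of `|t|`" [cite: Mochizuki2012, Cor 3.5 (i) p.94]. The constants
`Ψ_cns ≅ O^▷` are Kummer classes PULLED BACK from `G_v` along `Π ↠ G_v`; restricting them to a decomposition group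
`D_{t,μ_-}`, the image of a SECTION `ι_t : G_v → Π` of that projection, returns the `G_v`-level class — for every label.
In the continuous-cohomology model (abc-iut-L6-t1 `CohomologySystemOfContH1`, abc-iut-w4-d004 `h1LimComap` /
`h1LimCongr`) this is the identity `ι_t^* ∘ proj^* = (proj ∘ ι_t)^* = id^* = id` on `lim_{K₀} H¹(G_v ⊓ K₀, A)`:
* `h1LimComap_comp` — **functoriality**: `ι₁^* ∘ ι₂^* = (ι₂ ∘ ι₁)^*` on the limits (levelwise L2
  `ContH1.comap`, whose composite along `ι₂ ∘ ι₁` is the composite of the pull-backs by `rfl` on cocycles);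
* `h1LimCongr_comap_id` — the pull-back along the identity (read through the transport `h1LimCongr` along
  `φ ∘ id = φ`) is the identity;
* `h1LimCongr_comap_section` — **the section identity**: for `proj : Π → G_v`, `ι : G_v → Π` with `proj ∘ ι = id`,
  `h1LimCongr (…) (ι^* (proj^* y)) = y` — input (R) "`R_t (κ m) = κ₀ m`" of the restriction-iso clause, at the model,
  for EVERY section `ι = ι_t` (label-independence of the restricted constants).
Elementary [cite: NeukirchSchmidtWingberg2008, I §5]; nothing of [IUTchII] is asserted (claim key of the interface
`Mochizuki2012`, D-0012 disputed; no side taken on [IUTchIII] Cor. 3.12). NO definition, NO `Prop` fact.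
-/

namespace Literature.IUT.HodgeArakelov

open Literature.AnabelianGeometry.EtaleTheta CohomologySystemOfContH1

universe u

/-! ### 1. Functoriality of the pull-back -/

section Comp

variable {P₀ P₁ P : TopGroup.{u}} {G' : Type u} [Group G'] [TopologicalSpace G'] [IsTopologicalGroup G']
  (φ : P →* G') (A : Subgroup G') [A.Normal] [IsMulCommutative A]
  (ι₂ : P₁ →* P) (hι₂ : Continuous ι₂) (ι₁ : P₀ →* P₁) (hι₁ : Continuous ι₁)
  {H₀ : Subgroup P₀} {H₁ : Subgroup P₁} {H : Subgroup P} (h₂ : H₁.map ι₂ ≤ H) (h₁ : H₀.map ι₁ ≤ H₁)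

/-- Levelwise: the composite of L2's pull-backs along `ι₂` then `ι₁` is the pull-back along `ι₂ ∘ ι₁` (`rfl` on
cocycles). [cite: NeukirchSchmidtWingberg2008, I §5] -/
theorem gmodComap_gmodComap (h : H₀.map (ι₂.comp ι₁) ≤ H) (i : Idx (P := P) ⊥) (x : Gmod φ A H ⊥ i) :
    gmodComap (φ.comp ι₂) A ι₁ hι₁ h₁ (Idx.comap ι₂ hι₂ i) (gmodComap φ A ι₂ hι₂ h₂ i x) =
      gmodComap φ A (ι₂.comp ι₁) (hι₂.comp hι₁) h i x := by
  induction x using QuotientGroup.induction_on with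
  | H f => rfl

/-- **Functoriality of the pull-back of the limits**: `ι₁^* ∘ ι₂^* = (ι₂ ∘ ι₁)^*`.
[cite: NeukirchSchmidtWingberg2008, I §5] -/
theorem h1LimComap_comp (h : H₀.map (ι₂.comp ι₁) ≤ H) (y : h1Lim φ A H ⊥) :
    h1LimComap (φ.comp ι₂) A ι₁ hι₁ h₁ (h1LimComap φ A ι₂ hι₂ h₂ y) =
      h1LimComap φ A (ι₂.comp ι₁) (hι₂.comp hι₁) h y := by
  have key : (h1LimComap (φ.comp ι₂) A ι₁ hι₁ h₁).comp (h1LimComap φ A ι₂ hι₂ h₂) =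
      h1LimComap φ A (ι₂.comp ι₁) (hι₂.comp hι₁) h := by
    refine h1Lim_hom_ext φ A H fun i x => ?_
    change h1LimComap (φ.comp ι₂) A ι₁ hι₁ h₁ (h1LimComap φ A ι₂ hι₂ h₂ (h1Of φ A H ⊥ i x)) =
      h1LimComap φ A (ι₂.comp ι₁) (hι₂.comp hι₁) h (h1Of φ A H ⊥ i x)
    rw [h1LimComap_of, h1LimComap_of, h1LimComap_of, gmodComap_gmodComap]
    rfl
  exact DFunLike.congr_fun key y

end Comp

/-! ### 2. Pull-back along the identity, and the section identity -/

section Section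

variable {P₀ P : TopGroup.{u}} {G' : Type u} [Group G'] [TopologicalSpace G'] [IsTopologicalGroup G']
  (φ₀ : P₀ →* G') (A : Subgroup G') [A.Normal] [IsMulCommutative A]

/-- The pull-back along (a map equal to) the identity, read through the transport along `φ₀ ∘ e = φ₀`, is the
identity of `lim_{K₀} H¹(⊤ ⊓ K₀, A)`. [cite: NeukirchSchmidtWingberg2008, I §5] -/
theorem h1LimCongr_comap_id (e : P₀ →* P₀) (he : e = MonoidHom.id P₀) (hec : Continuous e)
    (hH : (⊤ : Subgroup P₀).map e ≤ ⊤) (hφ : φ₀.comp e = φ₀) (y : h1Lim φ₀ A ⊤ ⊥) :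
    h1LimCongr A ⊤ hφ ⊥ (h1LimComap φ₀ A e hec hH y) = y := by
  subst he
  have key : (h1LimCongr A ⊤ hφ ⊥).toAddMonoidHom.comp (h1LimComap φ₀ A (MonoidHom.id P₀) hec hH) =
      AddMonoidHom.id _ := by
    refine h1Lim_hom_ext φ₀ A ⊤ fun i x => ?_
    change h1LimCongr A ⊤ hφ ⊥ (h1LimComap φ₀ A (MonoidHom.id P₀) hec hH (h1Of φ₀ A ⊤ ⊥ i x)) = h1Of φ₀ A ⊤ ⊥ i x
    rw [h1LimComap_of]
    induction x using QuotientGroup.induction_on with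
    | H f => rfl
  exact DFunLike.congr_fun key y

variable (N : Subgroup P) (proj : P →* P₀) (hproj : Continuous proj) (ι : P₀ →* P) (hι : Continuous ι)
  (hN : (⊤ : Subgroup P₀).map ι ≤ N)

/-- **The section identity** `ι^* ∘ proj^* = id` on `lim_{K₀} H¹(G_v ⊓ K₀, A)`: a Kummer class of `G_v` pulled back
to `Π_Ÿ ⊆ Π` along `proj : Π ↠ G_v` and then restricted to the decomposition group `D_{t,μ_-} = ι_t(G_v)` along the
SECTION `ι_t` is the class one started with — for every section; this is input (R) "`R_t (κ m) = κ₀ m`, independently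
of `t`" of the restriction-isomorphism clause of [IUTchII] Cor 3.5 at the cohomology model.
[cite: Mochizuki2012, Cor 3.5 (i) p.94] -/
theorem h1LimCongr_comap_section (hsec : proj.comp ι = MonoidHom.id P₀) (hNp : N.map proj ≤ ⊤)
    (hφ : (φ₀.comp proj).comp ι = φ₀) (y : h1Lim φ₀ A ⊤ ⊥) :
    h1LimCongr A ⊤ hφ ⊥ (h1LimComap (φ₀.comp proj) A ι hι hN (h1LimComap φ₀ A proj hproj hNp y)) = y := by
  have h : (⊤ : Subgroup P₀).map (proj.comp ι) ≤ ⊤ := le_top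
  rw [h1LimComap_comp φ₀ A proj hproj ι hι hNp hN h]
  exact h1LimCongr_comap_id φ₀ A (proj.comp ι) hsec (hproj.comp hι) h hφ y

end Section

end Literature.IUT.HodgeArakelov
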